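import Summits.ResolutionOfSingularities.ResolutionOfSingularities.Theorems.HilbertSamuelEliminationSigmaMaxModificationsEliminationIsModification
import Summits.ResolutionOfSingularities.ResolutionOfSingularities.Theorems.HilbertSamuelEliminationSigmaMaxModificationsGluing
import Summits.ResolutionOfSingularities.ResolutionOfSingularities.Theorems.HilbertSamuelEliminationSigmaMaxModificationsSemicontinuitySharp
import Summits.ResolutionOfSingularities.ResolutionOfSingularities.Theorems.HilbertSamuelEliminationSigmaMaxModificationsMaxLocusClosed
import Summits.ResolutionOfSingularities.ResolutionOfSingularities.Theorems.SigmaMaxModifications.Negative.Levels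
import Literature.AlgebraicGeometry.Resolution.HilbertSamuelLocal
import Literature.AlgebraicGeometry.Resolution.HilbertSamuelLowerBound
import Literature.AlgebraicGeometry.Resolution.HilbertSamuelIsolatedSingularities
import Literature.AlgebraicGeometry.Resolution.HilbertSamuelGenericConstancyExcellent
import Literature.AlgebraicGeometry.Resolution.ExcellentRingsFieldProofs
import Mathlib.AlgebraicGeometry.Morphisms.Proper
import Mathlib.AlgebraicGeometry.Noetherian
import HarnessLib

/-!
# `SigmaMaxModifications` (crux stmt-ResolutionOfSingularities-18506, line `Sketch`):
# stub `stub_surface_of_sigmaMaxFact` — surfaces at EVERY level `N ≥ 2` from the glued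
# Cossart–Jannsen–Saito fact at level `2`

Stub `stub_surface_of_sigmaMaxFact` of the lead skeleton `Sketch` for the crux
`Summit.ResolutionOfSingularities.ResolutionOfSingularities.Theses.HilbertSamuelElimination.SigmaMaxModifications`
(Cossart–Jannsen–Saito, LNM 2270, Def. 6.15: `Σ^max`-modifications of reduced finite type `X/k`
at every level `N ≥ dim X`). The antecedent is the tree's named fact
`CossartJannsenSaito2020_sigmaMaxElimination` (Σ^max-eliminations of reduced excellent
Noetherian non-regular `X` of dimension `≤ 2`, at LEVEL `2` ONLY); the conclusion is the crux body
`B(X, N)` for `dim X ≤ 2` and every `N ≥ 2`.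

Proof (induction on `N ≥ 2`). `N = 2` is the landed `sigmaMaxModifications_dim_le_two`. Step
`N → N + 1` for `X/k` reduced of finite type, `dim X ≤ 2`, `dim X ≤ N + 1` (so `dim X ≤ N`):
let `S = {μ | μ^{(1)} ∈ Σ^max_X(N+1)}` and `U₁ = {x | ∃ μ ∈ S, H^N_X(x) ≤ μ}`. Since the strata
`X_N(≥ λ)` are closed at `N ≥ dim X` (`stub_isClosed_hsMaxLocus_over_field` fed by
`stub_hsFun_le_of_specializes_over_field`) and `Σ_X(N)` is finite, each `{H^N_X ≤ μ}` is open, so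
`U₁` is OPEN; `X_max(N+1) ⊆ U₁` (`H^{N+1} = (H^N)^{(1)}`, CJS Rem. 2.29 (b)), and a value `μ`
is maximal in `Σ_{U₁}(N)` iff `μ ∈ S`, whence `(U₁)_max(N) = U₁ ∩ X_max(N+1)` on the nose. The
open subscheme `U₁` is reduced of finite type over `k`, of dimension `≤ 2` and `≤ N`, and not
regular (it contains the non-empty `X_max(N+1) ⊆ Sing X`), so the induction hypothesis gives a
level-`N` `Σ^max`-modification `ρ : Y → U₁`; read at level `N + 1` (monotonicity and (ME2) move
up along `ν ↦ ν^{(1)}`, refuter kit `Negative/Levels`) it is a local witness over the open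
neighbourhood `U₁` of `X_max(N+1)`, which `sigmaMaxModification_of_localWitness` glues with the
identity of `X ∖ X_max(N+1)`.

## Sources

* V. Cossart, U. Jannsen, S. Saito, *Desingularization: Invariants and Strategy — Application
  to Dimension 2*, LNM 2270 (2020), Def. 2.28, Rem. 2.29 (b), Lemma 2.34, Def. 2.35, Lemma 2.36,
  Def. 6.15, Thm. 6.28. [CossartJannsenSaito2020]
-/

set_option linter.dupNamespace false -- mandated namespace of this single-conjunct summit

noncomputable section

open CategoryTheory AlgebraicGeometry TopologicalSpace Topology
open Literature.AlgebraicGeometry.Resolution Literature.RingTheory.HilbertSamuel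

namespace Summit.ResolutionOfSingularities.ResolutionOfSingularities.Theorems.SigmaMaxModifications.Sketch

/-! ## Topology of the strata: the sub-level sets `{H^N_X ≤ μ}` are open -/

/-- **The sub-level set `{x | H^N_X(x) ≤ μ}` is open** when every `X(≥ λ)` is closed (upper
semicontinuity, CJS Thm. 2.33 (3)) and `Σ_X(N)` is finite (Lemma 2.36): its complement is the
finite union of the closed `X(≥ λ)` over the values `λ` with `¬ λ ≤ μ` (Lemma 2.34 (a)).
[cite: CossartJannsenSaito2020, Def. 6.15, Rem. 2.29 (b), Lemma 2.36] -/
private theorem isOpen_setOf_hsFun_le {X : Scheme.{0}} {N : ℕ}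
    (husc : ∀ ν : ℕ → ℕ, IsClosed (Scheme.hsStratumGE X N ν))
    (hfin : (Scheme.hsValues X N).Finite) (μ : ℕ → ℕ) :
    IsOpen {x : X | Scheme.hsFun X N x ≤ μ} := by
  have h : {x : X | Scheme.hsFun X N x ≤ μ}ᶜ =
      ⋃ ν ∈ {ν ∈ Scheme.hsValues X N | ¬ ν ≤ μ}, Scheme.hsStratumGE X N ν := by
    ext x
    simp only [Set.mem_compl_iff, Set.mem_setOf_eq, Set.mem_iUnion, Scheme.mem_hsStratumGE_iff,
      exists_prop]
    exact ⟨fun hx => ⟨_, ⟨⟨x, rfl⟩, hx⟩, le_rfl⟩,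
      fun ⟨ν, ⟨_, hνμ⟩, hνx⟩ hxμ => hνμ (hνx.trans hxμ)⟩
  rw [← isClosed_compl_iff, h]
  exact (hfin.subset (Set.sep_subset _ _)).isClosed_biUnion fun ν _ => husc ν

/-! ## Level transfer through the open `U₁ = {x | ∃ μ, μ^{(1)} ∈ Σ^max_X(N+1), H^N_X(x) ≤ μ}` -/

/-- If `μ^{(1)}` is a maximal value of `Σ_X(N+1)` and `dim X ≤ N`, then `μ` is a (maximal) value
of `Σ_X(N)`: `μ^{(1)} = H^{N+1}_X(x) = (H^N_X(x))^{(1)}` and partial summation is injective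
(CJS Rem. 2.29 (b)). [cite: CossartJannsenSaito2020, Def. 6.15, Rem. 2.29 (b), Lemma 2.36] -/
private theorem maximal_of_maximal_psum {X : Scheme.{0}} [IsLocallyNoetherian X] {N : ℕ}
    (hdim : topologicalKrullDim X ≤ (N : WithBot ℕ∞)) {μ : ℕ → ℕ}
    (hμ : Maximal (· ∈ Scheme.hsValues X (N + 1)) (psum μ)) :
    Maximal (· ∈ Scheme.hsValues X N) μ := by
  obtain ⟨x, hx⟩ := hμ.1
  rw [Negative.hsFun_succ x (Negative.hsPsi_le_of_dim_le hdim x)] at hx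
  exact Negative.maximal_of_maximal_psum_succ hdim ⟨x, psum_injective hx⟩ hμ

/-- **Maximal values of the open `U₁`.** For `dim X ≤ N` and the open
`U₁ = {x | ∃ μ, μ^{(1)} ∈ Σ^max_X(N+1), H^N_X(x) ≤ μ}`: a function `μ` is a maximal value of
`Σ_{U₁}(N)` iff `μ^{(1)}` is a maximal value of `Σ_X(N+1)`. (⇐) such a `μ` is a maximal value of
`Σ_X(N) ⊇ Σ_{U₁}(N)` attained at a point of `U₁`; (⇒) a maximal value `μ = H^N_X(u)`, `u ∈ U₁`,
lies below some such `μ'`, which is a value of `Σ_{U₁}(N)`, so `μ = μ'`.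
[cite: CossartJannsenSaito2020, Def. 6.15, Rem. 2.29 (b), Lemma 2.36] -/
private theorem maximal_hsValues_opens_iff {X : Scheme.{0}} [IsLocallyNoetherian X] {N : ℕ}
    (hdim : topologicalKrullDim X ≤ (N : WithBot ℕ∞)) {U₁ : X.Opens}
    (hU₁ : ∀ x : X, x ∈ U₁ ↔ ∃ μ : ℕ → ℕ,
      Maximal (· ∈ Scheme.hsValues X (N + 1)) (psum μ) ∧ Scheme.hsFun X N x ≤ μ)
    (μ : ℕ → ℕ) :
    Maximal (· ∈ Scheme.hsValues (U₁ : Scheme.{0}) N) μ ↔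
      Maximal (· ∈ Scheme.hsValues X (N + 1)) (psum μ) := by
  -- (⇐): a member of `S` is a value of `Σ_{U₁}(N)` and a maximal value of `Σ_X(N) ⊇ Σ_{U₁}(N)`
  have key : ∀ μ : ℕ → ℕ, Maximal (· ∈ Scheme.hsValues X (N + 1)) (psum μ) →
      Maximal (· ∈ Scheme.hsValues (U₁ : Scheme.{0}) N) μ := by
    intro μ hμ
    have hmax : Maximal (· ∈ Scheme.hsValues X N) μ := maximal_of_maximal_psum hdim hμ
    obtain ⟨x, hx⟩ := hmax.1
    have hxU : x ∈ U₁ := (hU₁ x).mpr ⟨μ, hμ, hx.le⟩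
    refine ⟨⟨⟨x, hxU⟩, ?_⟩, fun ν hν hle => ?_⟩
    · rw [Scheme.hsFun_opens]
      exact hx
    · exact hmax.2 (Scheme.hsValues_subset_of_isOpenImmersion U₁.ι N hν) hle
  refine ⟨fun hμ => ?_, key μ⟩
  obtain ⟨u, hu⟩ := hμ.1
  obtain ⟨μ', hμ', hle⟩ := (hU₁ u.1).mp u.2
  have hle' : μ ≤ μ' := by
    rw [← hu, Scheme.hsFun_opens]
    exact hle
  have heq : μ = μ' := le_antisymm hle' (hμ.2 (key μ' hμ').1 hle')
  rw [heq]
  exact hμ'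

/-- **`(U₁)_max(N) = U₁ ∩ X_max(N+1)`** for the open `U₁` above (`dim X ≤ N`): by
`maximal_hsValues_opens_iff`, `H^N_{U₁} = H^N_X|_{U₁}` (the Hilbert–Samuel function is local)
and `H^{N+1}_X = (H^N_X)^{(1)}`.
[cite: CossartJannsenSaito2020, Def. 6.15, Rem. 2.29 (b), Lemma 2.36] -/
private theorem mem_hsMaxLocus_opens_iff {X : Scheme.{0}} [IsLocallyNoetherian X] {N : ℕ}
    (hdim : topologicalKrullDim X ≤ (N : WithBot ℕ∞)) {U₁ : X.Opens}
    (hU₁ : ∀ x : X, x ∈ U₁ ↔ ∃ μ : ℕ → ℕ,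
      Maximal (· ∈ Scheme.hsValues X (N + 1)) (psum μ) ∧ Scheme.hsFun X N x ≤ μ)
    (u : (U₁ : Scheme.{0})) :
    u ∈ Scheme.hsMaxLocus (U₁ : Scheme.{0}) N ↔
      U₁.ι.base u ∈ Scheme.hsMaxLocus X (N + 1) := by
  rw [Scheme.mem_hsMaxLocus_iff, Scheme.mem_hsMaxLocus_iff, maximal_hsValues_opens_iff hdim hU₁,
    Scheme.hsFun_opens, Negative.hsFun_succ _ (Negative.hsPsi_le_of_dim_le hdim _)]

/-- **`X_max(N+1) ⊆ U₁`** for the open `U₁` above (`dim X ≤ N`): for `x ∈ X_max(N+1)` the value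
`μ = H^N_X(x)` has `μ^{(1)} = H^{N+1}_X(x)` maximal.
[cite: CossartJannsenSaito2020, Def. 6.15, Rem. 2.29 (b), Lemma 2.36] -/
private theorem hsMaxLocus_succ_subset_opens {X : Scheme.{0}} [IsLocallyNoetherian X] {N : ℕ}
    (hdim : topologicalKrullDim X ≤ (N : WithBot ℕ∞)) {U₁ : X.Opens}
    (hU₁ : ∀ x : X, x ∈ U₁ ↔ ∃ μ : ℕ → ℕ,
      Maximal (· ∈ Scheme.hsValues X (N + 1)) (psum μ) ∧ Scheme.hsFun X N x ≤ μ) :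
    ∀ x : X, x ∈ Scheme.hsMaxLocus X (N + 1) → x ∈ U₁ := by
  intro x hx
  rw [Scheme.mem_hsMaxLocus_iff, Negative.hsFun_succ x (Negative.hsPsi_le_of_dim_le hdim x)] at hx
  exact (hU₁ x).mpr ⟨_, hx, le_rfl⟩

/-! ## The induction step `N → N + 1` -/

/-- **Step `N → N + 1` of the level induction** (CJS Def. 6.15 at level `N + 1` from level `N`,
for surfaces). Assume the crux body `B(Y, N)` for all `Y/k` reduced of finite type, not regular,
`dim Y ≤ 2`, `dim Y ≤ N` (`2 ≤ N`), and let `X/k` be such with `dim X ≤ N + 1` (so `dim X ≤ N`).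
The open `U₁ = {x | ∃ μ, μ^{(1)} ∈ Σ^max_X(N+1), H^N_X(x) ≤ μ}` (open since the `X_N(≥ λ)` are
closed at `N ≥ dim X`, `stub_isClosed_hsMaxLocus_over_field` ∘
`stub_hsFun_le_of_specializes_over_field`, and `Σ_X(N)` is finite) contains `X_max(N+1)`,
satisfies `(U₁)_max(N) = U₁ ∩ X_max(N+1)`, and is
not regular (`∅ ≠ X_max(N+1) ⊆ Sing X`); `B(U₁, N)` read at level `N + 1` (`H^{N+1} = (H^N)^{(1)}`,
Rem. 2.29 (b): monotonicity and (ME2) move up, refuter kit `Negative/Levels`) is a local witness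
which `sigmaMaxModification_of_localWitness` glues with the identity of `X ∖ X_max(N+1)`.
[cite: CossartJannsenSaito2020, Def. 6.15, Rem. 2.29 (b), Lemma 2.36] -/
private theorem surface_succ (k : Type) [Field k] (N : ℕ) (hN : 2 ≤ N)
    (ih : ∀ (X : Scheme.{0}) (f : X ⟶ Spec (.of k)), LocallyOfFiniteType f → QuasiCompact f →
      IsReduced X → ¬ Scheme.IsRegular X → topologicalKrullDim X ≤ ((2 : ℕ) : WithBot ℕ∞) →
      topologicalKrullDim X ≤ (N : WithBot ℕ∞) →
      ∃ (X' : Scheme.{0}) (π : X' ⟶ X), IsProper π ∧ IsReduced X' ∧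
        topologicalKrullDim X' ≤ (N : WithBot ℕ∞) ∧
        (∀ U : X.Opens, (U : Set X) ⊆ (Scheme.hsMaxLocus X N)ᶜ → IsIso (π ∣_ U)) ∧
        Dense ((fun x' => π.base x') ⁻¹' (Scheme.hsMaxLocus X N)ᶜ) ∧
        (∀ x' : X', Scheme.hsFun X' N x' ≤ Scheme.hsFun X N (π.base x')) ∧
        ∀ ν : ℕ → ℕ, Maximal (· ∈ Scheme.hsValues X N) ν → ν ∉ Scheme.hsValues X' N)
    (X : Scheme.{0}) (f : X ⟶ Spec (.of k)) (hft : LocallyOfFiniteType f) (hqc : QuasiCompact f)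
    (hred : IsReduced X) (hreg : ¬ Scheme.IsRegular X)
    (hdim2 : topologicalKrullDim X ≤ ((2 : ℕ) : WithBot ℕ∞))
    (hdimN1 : topologicalKrullDim X ≤ ((N + 1 : ℕ) : WithBot ℕ∞)) :
    ∃ (X' : Scheme.{0}) (π : X' ⟶ X), IsProper π ∧ IsReduced X' ∧
      topologicalKrullDim X' ≤ ((N + 1 : ℕ) : WithBot ℕ∞) ∧
      (∀ U : X.Opens, (U : Set X) ⊆ (Scheme.hsMaxLocus X (N + 1))ᶜ → IsIso (π ∣_ U)) ∧
      Dense ((fun x' => π.base x') ⁻¹' (Scheme.hsMaxLocus X (N + 1))ᶜ) ∧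
      (∀ x' : X', Scheme.hsFun X' (N + 1) x' ≤ Scheme.hsFun X (N + 1) (π.base x')) ∧
      ∀ ν : ℕ → ℕ, Maximal (· ∈ Scheme.hsValues X (N + 1)) ν →
        ν ∉ Scheme.hsValues X' (N + 1) := by
  haveI := hft
  haveI := hqc
  haveI := hred
  haveI : IsLocallyNoetherian X := LocallyOfFiniteType.isLocallyNoetherian f
  haveI : IsNoetherian X := Scheme.isNoetherian_of_finiteType_over_field f
  have hexc : Scheme.IsExcellent X :=
    Scheme.isExcellent_of_locallyOfFiniteType Stacks07QW_field_holds f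
  have hdimN : topologicalKrullDim X ≤ (N : WithBot ℕ∞) := hdim2.trans (by exact_mod_cast hN)
  have hψ : ∀ x : X, Scheme.hsPsi X x ≤ N := Negative.hsPsi_le_of_dim_le hdimN
  have hψ1 : ∀ x : X, Scheme.hsPsi X x ≤ N + 1 := fun x => (hψ x).trans N.le_succ
  have hcl := stub_isClosed_hsMaxLocus_over_field stub_hsFun_le_of_specializes_over_field k X f
    hft hqc
  have hfin : (Scheme.hsValues X N).Finite := Scheme.finite_hsValues_of_isExcellent hexc N hψ
  have hfin1 : (Scheme.hsValues X (N + 1)).Finite :=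
    Scheme.finite_hsValues_of_isExcellent hexc (N + 1) hψ1
  -- the open neighbourhood `U₁` of `X_max(N+1)`
  obtain ⟨U₁, hU₁⟩ : ∃ U₁ : X.Opens, ∀ x : X, x ∈ U₁ ↔ ∃ μ : ℕ → ℕ,
      Maximal (· ∈ Scheme.hsValues X (N + 1)) (psum μ) ∧ Scheme.hsFun X N x ≤ μ :=
    ⟨⟨⋃ μ ∈ {μ : ℕ → ℕ | Maximal (· ∈ Scheme.hsValues X (N + 1)) (psum μ)},
        {x : X | Scheme.hsFun X N x ≤ μ},
      isOpen_biUnion fun μ _ => isOpen_setOf_hsFun_le (hcl N hdimN).1 hfin μ⟩,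
      fun x => by simp only [Opens.mem_mk, Set.mem_iUnion, Set.mem_setOf_eq, exists_prop]⟩
  have hsub : ∀ x : X, x ∈ Scheme.hsMaxLocus X (N + 1) → x ∈ U₁ :=
    hsMaxLocus_succ_subset_opens hdimN hU₁
  have hmaxU : ∀ u : (U₁ : Scheme.{0}), u ∈ Scheme.hsMaxLocus (U₁ : Scheme.{0}) N ↔
      U₁.ι.base u ∈ Scheme.hsMaxLocus X (N + 1) := mem_hsMaxLocus_opens_iff hdimN hU₁
  -- the open complement of `X_max(N+1)`; `Zc ∪ U₁ = X`
  obtain ⟨Zc, hZc⟩ : ∃ Zc : X.Opens, (Zc : Set X) = (Scheme.hsMaxLocus X (N + 1))ᶜ :=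
    ⟨⟨_, (hcl (N + 1) hdimN1).2.isOpen_compl⟩, rfl⟩
  have hmemZc : ∀ x : X, x ∈ Zc ↔ x ∉ Scheme.hsMaxLocus X (N + 1) := fun x => by
    rw [← SetLike.mem_coe, hZc, Set.mem_compl_iff]
  have hcover : Zc ⊔ U₁ = ⊤ := by
    ext x
    simp only [Opens.coe_sup, Set.mem_union, SetLike.mem_coe, Opens.coe_top, Set.mem_univ,
      iff_true]
    by_cases hx : x ∈ Scheme.hsMaxLocus X (N + 1)
    · exact Or.inr (hsub x hx)
    · exact Or.inl ((hmemZc x).mpr hx)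
  -- `U₁` is not regular: it contains the non-empty `X_max(N+1) ⊆ Sing X`
  have hUreg : ¬ Scheme.IsRegular (U₁ : Scheme.{0}) := by
    obtain ⟨x₀, _⟩ := not_forall.mp hreg
    haveI : Nonempty X := ⟨x₀⟩
    obtain ⟨x, hx⟩ := Scheme.hsMaxLocus_nonempty_of_finite (X := X) hfin1
    have hxreg : x ∉ Scheme.regularLocus X :=
      Scheme.hsMaxLocus_subset_compl_regularLocus
        (fun x => exists_ringKrullDim_stalk_eq_of_topologicalKrullDim_le hdimN1 x) hreg hx
    intro hU
    haveI := hU ⟨x, hsub x hx⟩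
    exact hxreg (IsRegularLocalRing.of_ringEquiv
      (asIso (U₁.ι.stalkMap ⟨x, hsub x hx⟩)).commRingCatIsoToRingEquiv.symm)
  -- the induction hypothesis on the open subscheme `U₁`
  have hUdim2 : topologicalKrullDim (U₁ : Scheme.{0}) ≤ ((2 : ℕ) : WithBot ℕ∞) :=
    (topologicalKrullDim_subspace_le X (U₁ : Set X)).trans hdim2
  have hUdimN : topologicalKrullDim (U₁ : Scheme.{0}) ≤ (N : WithBot ℕ∞) :=
    (topologicalKrullDim_subspace_le X (U₁ : Set X)).trans hdimN
  obtain ⟨Y, ρ, hprop, hYred, hYdim, hiso, hdense, hmono, hkill⟩ :=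
    ih (U₁ : Scheme.{0}) (U₁.ι ≫ f) inferInstance inferInstance inferInstance hUreg hUdim2 hUdimN
  haveI := hprop
  haveI : IsLocallyNoetherian Y := LocallyOfFiniteType.isLocallyNoetherian ρ
  have hψY : ∀ y : Y, Scheme.hsPsi Y y ≤ N := Negative.hsPsi_le_of_dim_le hYdim
  -- glue the level-`N` witness over `U₁`, read at level `N + 1`, with the identity of `Zc`
  refine sigmaMaxModification_of_localWitness X (N + 1) hdimN1 Zc U₁ hZc hcover Y ρ hprop hYred
    (hYdim.trans (by exact_mod_cast N.le_succ)) ?_ ?_ ?_ ?_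
  · -- `ρ` is an isomorphism over `U₁ ∩ Zc = U₁ ∖ (U₁)_max(N)`
    refine hiso _ fun u hu hu' => ?_
    have hu₂ : U₁.ι.base u ∈ Zc := hu
    exact (hmemZc _).mp hu₂ ((hmaxU u).mp hu')
  · -- the preimage of `U₁ ∩ Zc` is the (dense) preimage of `U₁ ∖ (U₁)_max(N)`
    refine hdense.mono fun y hy => ?_
    show U₁.ι.base (ρ.base y) ∈ Zc
    exact (hmemZc _).mpr fun h => hy ((hmaxU _).mpr h)
  · -- `H^{N+1}` does not increase
    intro y
    refine Negative.hsFun_succ_le_of_le (hψ _) (hψY y) ?_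
    rw [← Scheme.hsFun_opens U₁ N (ρ.base y)]
    exact hmono y
  · -- (ME2) at level `N + 1`
    rintro ν hν ⟨y, hy⟩
    rw [Negative.hsFun_succ y (hψY y)] at hy
    subst hy
    exact hkill _ ((maximal_hsValues_opens_iff hdimN hU₁ _).mpr hν) ⟨y, rfl⟩

/-- **Surfaces at every level `N ≥ 2`** (the crux body `B(X, N)` for `X/k` reduced of finite
type, not regular, `dim X ≤ 2`, `dim X ≤ N`), from the glued CJS fact at level `2`: induction on
`N`, base `sigmaMaxModifications_dim_le_two`, step `surface_succ`.
[cite: CossartJannsenSaito2020, Def. 6.15, Rem. 2.29 (b), Lemma 2.36] -/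
private theorem surface_allLevels (h : CossartJannsenSaito2020_sigmaMaxElimination.{0})
    (k : Type) [Field k] (N : ℕ) (hN : 2 ≤ N) :
    ∀ (X : Scheme.{0}) (f : X ⟶ Spec (.of k)), LocallyOfFiniteType f → QuasiCompact f →
      IsReduced X → ¬ Scheme.IsRegular X → topologicalKrullDim X ≤ ((2 : ℕ) : WithBot ℕ∞) →
      topologicalKrullDim X ≤ (N : WithBot ℕ∞) →
      ∃ (X' : Scheme.{0}) (π : X' ⟶ X), IsProper π ∧ IsReduced X' ∧
        topologicalKrullDim X' ≤ (N : WithBot ℕ∞) ∧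
        (∀ U : X.Opens, (U : Set X) ⊆ (Scheme.hsMaxLocus X N)ᶜ → IsIso (π ∣_ U)) ∧
        Dense ((fun x' => π.base x') ⁻¹' (Scheme.hsMaxLocus X N)ᶜ) ∧
        (∀ x' : X', Scheme.hsFun X' N x' ≤ Scheme.hsFun X N (π.base x')) ∧
        ∀ ν : ℕ → ℕ, Maximal (· ∈ Scheme.hsValues X N) ν → ν ∉ Scheme.hsValues X' N := by
  induction N, hN using Nat.le_induction with
  | base =>
    intro X f hft hqc hred hreg hdim2 _
    exact sigmaMaxModifications_dim_le_two h k X f hft hqc hred hreg (by exact_mod_cast hdim2)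
  | succ N hN ih =>
    intro X f hft hqc hred hreg hdim2 hdimN1
    exact surface_succ k N hN ih X f hft hqc hred hreg hdim2 hdimN1

/-! ## The stub -/

/-- **STUB `stub_surface_of_sigmaMaxFact` (line `Sketch`): the crux body for surfaces at EVERY
level `N ≥ 2` from the glued named fact at level `2`.** `N = 2` is the landed
`sigmaMaxModifications_dim_le_two`. Step `N → N + 1` (for all `X/k` reduced of finite type,
`dim X ≤ 2`, `dim X ≤ N`): with `S` the set of `μ` with `μ^{(1)}` maximal in `Σ_X(N+1)` and
`U₁ = {x | ∃ μ ∈ S, H^N_X(x) ≤ μ}` — OPEN, each `{H^N_X ≤ μ}` having as complement the finite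
union of the closed (`stub_isClosed_hsMaxLocus_over_field`, sharp semicontinuity at `N ≥ dim X`)
sets `X_N(≥ λ)` over the values `λ` not below `μ`; `U₁ ⊇ X_max(N+1)` and
`(U₁)_max(N) = U₁ ∩ X_max(N+1)`; the level-`N` statement for the open subscheme `U₁` is a local
witness at level `N + 1` (monotonicity and the killing of maximal values move up one level along
`ν ↦ ν^{(1)}`, refuter kit `Negative/Levels`), which `sigmaMaxModification_of_localWitness`
glues with the identity on `X ∖ X_max(N+1)`. The separatedness hypothesis is not used.
[cite: CossartJannsenSaito2020, Def. 6.15, Rem. 2.29 (b), Lemma 2.36] -/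
theorem stub_surface_of_sigmaMaxFact :
    CossartJannsenSaito2020_sigmaMaxElimination.{0} →
    ∀ (k : Type) [Field k] (N : ℕ), 2 ≤ N →
      ∀ (X : Scheme.{0}) (f : X ⟶ Spec (.of k)), IsSeparated f → LocallyOfFiniteType f →
        QuasiCompact f → IsReduced X → ¬ Scheme.IsRegular X →
        topologicalKrullDim X ≤ ((2 : ℕ) : WithBot ℕ∞) →
        topologicalKrullDim X ≤ (N : WithBot ℕ∞) →
        ∃ (X' : Scheme.{0}) (π : X' ⟶ X), IsProper π ∧ IsReduced X' ∧
          topologicalKrullDim X' ≤ (N : WithBot ℕ∞) ∧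
          (∀ U : X.Opens, (U : Set X) ⊆ (Scheme.hsMaxLocus X N)ᶜ → IsIso (π ∣_ U)) ∧
          Dense ((fun x' => π.base x') ⁻¹' (Scheme.hsMaxLocus X N)ᶜ) ∧
          (∀ x' : X', Scheme.hsFun X' N x' ≤ Scheme.hsFun X N (π.base x')) ∧
          ∀ ν : ℕ → ℕ, Maximal (· ∈ Scheme.hsValues X N) ν → ν ∉ Scheme.hsValues X' N := by
  intro h k _ N hN X f _ hft hqc hred hreg hdim2 hdimN
  exact surface_allLevels h k N hN X f hft hqc hred hreg hdim2 hdimN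

end Summit.ResolutionOfSingularities.ResolutionOfSingularities.Theorems.SigmaMaxModifications.Sketch

end
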